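import Literature.NumberTheory.EllipticCurves.FramedTateGaloisRep
import Literature.NumberTheory.GaloisRepresentations.OrdinaryGaloisRep
import Literature.NumberTheory.GaloisRepresentations.ResidualRepresentation
import Summits.Langlands.Langlands.Theorems.EisensteinProModularSeed.Negative.OrientedFrame
import HarnessLib

/-!
# Integral frames of `V_ℓ E` and their residually upper-triangular integral models
(route `SkinnerWilesDefectOne`, item stmt-Langlands-12922 `FiveIsogenyEllipticCurves`, helper)

The target `ReducibleOrdinaryModular` is applied, in the headline corollary, to the `5`-adic Tate
module of an elliptic curve framed in a basis in which all matrices are `5`-adically integral and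
lower-left entries are divisible by `5` (a basis adapted to the `F`-rational `5`-isogeny).  This
file provides the bookkeeping, for any prime `ℓ` and the valuation ring `O` of `ℚ̄_ℓ` (pinned, as
in the route, by `O = Valued.v.valuationSubring`):

* `exists_integralModel_of_v_le_one`: a framed representation `r : G →ₜ* GL_n(ℚ̄_ℓ)` all of whose
  entries have valuation `≤ 1` has an integral model `r₀ : G →* GL_n(O)` in the SAME frame
  (`GL_n(O) → GL_n(ℚ̄_ℓ)` maps `r₀` to `r`), and if moreover the entries below the diagonal have
  valuation `< 1` then `r₀` is residually upper triangular
  (`FramedRep.HasUpperTriangularIntegralModel r r₀`);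
* `framedTateGaloisRepOfBasis` (with the tree's continuity witness) in a `ℚ_ℓ`-basis `b` of `V_ℓ E`
  whose matrices have entries of norm `≤ 1`: entries, and the residually upper-triangular integral
  model when the sub-diagonal entries have norm `< 1`.

References: J.-P. Serre, *Abelian ℓ-adic representations and elliptic curves* (1968), Ch. I §1.1
(lattices and integral models); C. Skinner, A. Wiles, Publ. Math. IHÉS 89 (1999), §4.6 (the
residually upper-triangular frame).
-/

noncomputable section

-- `Summit.Langlands.Langlands.…`: summit = sub-problem name (D-0017 layout), as in every Theorems file here.
set_option linter.dupNamespace false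

open scoped NumberField MatrixGroups Matrix
open Field IsDedekindDomain IsLocalRing
open Literature.NumberTheory.EllipticCurves Literature.NumberTheory.GaloisRepresentations
open Summit.Langlands.Langlands.Theorems.EisensteinProModularSeed.Negative (mem_maximalIdeal_of_v_lt_one)

namespace Summit.Langlands.Langlands.Theorems.FiveIsogenyEllipticCurves

universe u

/-! ### Integral models in the same frame, from integrality of entries -/

section IntegralModel

variable {p : ℕ} [Fact p.Prime] {O : ValuationSubring (PadicAlgCl p)} {G : Type*} [Group G]
  [TopologicalSpace G] {n : ℕ}

/-- Membership in the valuation ring `O = {v ≤ 1}` of `ℚ̄_p` (the `O` of the route, pinned by the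
hypothesis `O = Valued.v.valuationSubring`). [folklore] -/
theorem mem_O_iff (hO : O = (Valued.v : Valuation (PadicAlgCl p) NNReal).valuationSubring)
    {x : PadicAlgCl p} : x ∈ O ↔ Valued.v x ≤ 1 := by
  subst hO
  exact Valuation.mem_valuationSubring_iff _ _

/-- An element of the maximal ideal of `O` has valuation `< 1` (a valuation-`1` element of `O` is a
unit). [folklore] -/
theorem v_lt_one_of_mem_maximalIdeal
    (hO : O = (Valued.v : Valuation (PadicAlgCl p) NNReal).valuationSubring) {x : O}
    (hx : x ∈ maximalIdeal O) : Valued.v (x : PadicAlgCl p) < 1 := by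
  by_contra h
  have h1 : Valued.v (x : PadicAlgCl p) = 1 := le_antisymm ((mem_O_iff hO).mp x.2) (not_lt.mp h)
  apply (IsLocalRing.mem_maximalIdeal _).mp hx
  have hx0 : (x : PadicAlgCl p) ≠ 0 := by
    intro h0; rw [h0, map_zero] at h1; exact zero_ne_one h1
  have hinv : (x : PadicAlgCl p)⁻¹ ∈ O := by
    rw [mem_O_iff hO, map_inv₀, h1, inv_one]
  have hmul : x * ⟨(x : PadicAlgCl p)⁻¹, hinv⟩ = 1 := Subtype.ext (mul_inv_cancel₀ hx0)
  exact IsUnit.of_mul_eq_one _ hmul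

/-- For `x, y ∈ O`: `x - y ∈ 𝔪_O` iff `v (x - y) < 1`. [folklore] -/
theorem sub_mem_maximalIdeal_iff_v
    (hO : O = (Valued.v : Valuation (PadicAlgCl p) NNReal).valuationSubring) (x y : O) :
    x - y ∈ maximalIdeal O ↔ Valued.v ((x : PadicAlgCl p) - (y : PadicAlgCl p)) < 1 := by
  have e : ((x - y : O) : PadicAlgCl p) = (x : PadicAlgCl p) - (y : PadicAlgCl p) := rfl
  rw [← e]
  exact ⟨v_lt_one_of_mem_maximalIdeal hO, mem_maximalIdeal_of_v_lt_one hO⟩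

/-- An invertible matrix over `ℚ̄_p` whose entries and whose inverse's entries have valuation `≤ 1`
comes from `GL_n(O)`. [folklore] -/
theorem mem_range_map_of_v_le_one
    (hO : O = (Valued.v : Valuation (PadicAlgCl p) NNReal).valuationSubring)
    (g : GL (Fin n) (PadicAlgCl p))
    (h : ∀ i j, Valued.v (g.val i j) ≤ 1) (h' : ∀ i j, Valued.v ((g⁻¹).val i j) ≤ 1) :
    g ∈ (Matrix.GeneralLinearGroup.map (n := Fin n) O.subtype).range := by
  set A : Matrix (Fin n) (Fin n) O := fun i j => ⟨g.val i j, (mem_O_iff hO).mpr (h i j)⟩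
    with hAdef
  set B : Matrix (Fin n) (Fin n) O := fun i j => ⟨(g⁻¹).val i j, (mem_O_iff hO).mpr (h' i j)⟩
    with hBdef
  have hA : A.map O.subtype = g.val := Matrix.ext fun i j => by rw [hAdef]; rfl
  have hB : B.map O.subtype = (g⁻¹).val := Matrix.ext fun i j => by rw [hBdef]; rfl
  have hinj : Function.Injective (fun M : Matrix (Fin n) (Fin n) O => M.map O.subtype) :=
    fun M N hMN => Matrix.ext fun i j => O.subtype_injective (congrFun (congrFun hMN i) j)
  have h1 : (1 : Matrix (Fin n) (Fin n) O).map O.subtype = 1 :=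
    Matrix.map_one O.subtype (map_zero _) (map_one _)
  have hAB : A * B = 1 := by
    apply hinj
    change (A * B).map O.subtype = (1 : Matrix (Fin n) (Fin n) O).map O.subtype
    rw [Matrix.map_mul, hA, hB, h1, ← Units.val_mul, mul_inv_cancel, Units.val_one]
  have hBA : B * A = 1 := by
    apply hinj
    change (B * A).map O.subtype = (1 : Matrix (Fin n) (Fin n) O).map O.subtype
    rw [Matrix.map_mul, hA, hB, h1, ← Units.val_mul, inv_mul_cancel, Units.val_one]
  exact ⟨⟨A, B, hAB, hBA⟩, Units.ext hA⟩

/-- **Integral model in the same frame.**  A framed representation `r : G →ₜ* GL_n(ℚ̄_p)` all of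
whose entries have valuation `≤ 1` lifts to `r₀ : G →* GL_n(O)`, `O` the valuation ring of `ℚ̄_p`,
with `GL_n(O) → GL_n(ℚ̄_p)` mapping `r₀ g` to `r g` (Serre 1968, I.1.1: a stable lattice).
[folklore] -/
theorem exists_integralModel_of_v_le_one
    (hO : O = (Valued.v : Valuation (PadicAlgCl p) NNReal).valuationSubring)
    (r : FramedRep G (PadicAlgCl p) n) (h : ∀ g i j, Valued.v ((r g).val i j) ≤ 1) :
    ∃ r₀ : G →* GL (Fin n) O, ∀ g, Matrix.GeneralLinearGroup.map O.subtype (r₀ g) = r g := by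
  refine exists_monoidHom_map_eq (r : G →* GL (Fin n) (PadicAlgCl p)) fun g => ?_
  refine mem_range_map_of_v_le_one hO (r g) (h g) fun i j => ?_
  have := h g⁻¹ i j
  rwa [map_inv] at this

/-- **Residually upper-triangular integral model from the entries.**  If all entries of
`r : G →ₜ* GL_n(ℚ̄_p)` have valuation `≤ 1` and the entries below the diagonal have valuation `< 1`,
then `r` has a residually upper-triangular integral model over `O` in the same frame
(`FramedRep.HasUpperTriangularIntegralModel`). [folklore] -/
theorem exists_hasUpperTriangularIntegralModel
    (hO : O = (Valued.v : Valuation (PadicAlgCl p) NNReal).valuationSubring)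
    (r : FramedRep G (PadicAlgCl p) n) (h : ∀ g i j, Valued.v ((r g).val i j) ≤ 1)
    (hlow : ∀ g (i j : Fin n), j < i → Valued.v ((r g).val i j) < 1) :
    ∃ r₀ : G →* GL (Fin n) O, FramedRep.HasUpperTriangularIntegralModel r r₀ := by
  obtain ⟨r₀, hr₀⟩ := exists_integralModel_of_v_le_one hO r h
  refine ⟨r₀, hr₀, fun g i j hij => mem_maximalIdeal_of_v_lt_one hO ?_⟩
  have e : ((r₀ g).val i j : PadicAlgCl p) = (r g).val i j := by
    rw [← hr₀ g]; rfl
  rw [e]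
  exact hlow g i j hij

end IntegralModel

/-! ### Frames of `V_ℓ E` with integral matrices -/

section TateFrame

variable {K : Type u} [Field K] (W : WeierstrassCurve K) [W.IsElliptic] (ℓ : ℕ) [Fact ℓ.Prime]
  {O : ValuationSubring (PadicAlgCl ℓ)}

/-- The `(i, j)` entry of `V_ℓ E` framed in `b` at `σ` is the `(i, j)` entry of the matrix of `σ`
in `b`, mapped into `ℚ̄_ℓ`. [folklore] -/
theorem framedTateGaloisRepOfBasis_entry {m : ℕ}
    (b : Module.Basis (Fin m) ℚ_[ℓ] (W.rationalTateModule ℓ)) (σ : absoluteGaloisGroup K)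
    (i j : Fin m) :
    (W.framedTateGaloisRepOfBasis ℓ (W.continuous_rationalGaloisRepTate_holds ℓ) b σ).val i j =
      algebraMap ℚ_[ℓ] (PadicAlgCl ℓ) (LinearMap.toMatrix b b (W.rationalGaloisRepTate ℓ σ) i j) := by
  have e := W.coe_framedTateGaloisRepOfBasis_apply ℓ (W.continuous_rationalGaloisRepTate_holds ℓ) b σ
  exact congrFun (congrFun e i) j

/-- Valuations of entries in a basis with integral matrices are `≤ 1`. [folklore] -/
theorem v_entry_le_one {m : ℕ} {b : Module.Basis (Fin m) ℚ_[ℓ] (W.rationalTateModule ℓ)}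
    (hb : ∀ (σ : absoluteGaloisGroup K) (i j : Fin m),
      ‖LinearMap.toMatrix b b (W.rationalGaloisRepTate ℓ σ) i j‖ ≤ 1)
    (σ : absoluteGaloisGroup K) (i j : Fin m) :
    Valued.v ((W.framedTateGaloisRepOfBasis ℓ (W.continuous_rationalGaloisRepTate_holds ℓ) b σ).val
      i j) ≤ 1 := by
  rw [framedTateGaloisRepOfBasis_entry W ℓ b σ i j, PadicAlgCl.valuation_def, ← PadicAlgCl.coe_eq]
  change ‖((LinearMap.toMatrix b b (W.rationalGaloisRepTate ℓ σ) i j : ℚ_[ℓ]) : PadicAlgCl ℓ)‖₊ ≤ 1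
  rw [← NNReal.coe_le_coe, coe_nnnorm, PadicAlgCl.norm_extends]
  exact hb σ i j

/-- The valuation of an entry in the frame is `< 1` iff the corresponding matrix entry over `ℚ_ℓ`
has norm `< 1`. [folklore] -/
theorem v_entry_lt_one_iff {m : ℕ}
    (b : Module.Basis (Fin m) ℚ_[ℓ] (W.rationalTateModule ℓ)) (σ : absoluteGaloisGroup K)
    (i j : Fin m) :
    Valued.v ((W.framedTateGaloisRepOfBasis ℓ (W.continuous_rationalGaloisRepTate_holds ℓ) b σ).val
      i j) < 1 ↔ ‖LinearMap.toMatrix b b (W.rationalGaloisRepTate ℓ σ) i j‖ < 1 := by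
  rw [framedTateGaloisRepOfBasis_entry W ℓ b σ i j, PadicAlgCl.valuation_def, ← PadicAlgCl.coe_eq]
  change ‖((LinearMap.toMatrix b b (W.rationalGaloisRepTate ℓ σ) i j : ℚ_[ℓ]) : PadicAlgCl ℓ)‖₊ < 1 ↔ _
  rw [← NNReal.coe_lt_coe, coe_nnnorm, PadicAlgCl.norm_extends]
  rfl

/-- **The integral model of `V_ℓ E` framed in a basis with integral matrices**, residually upper
triangular as soon as the matrix entries below the diagonal have norm `< 1`
(`exists_hasUpperTriangularIntegralModel`). [folklore] -/
theorem exists_hasUpperTriangularIntegralModel_framedTate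
    (hO : O = (Valued.v : Valuation (PadicAlgCl ℓ) NNReal).valuationSubring) {m : ℕ}
    {b : Module.Basis (Fin m) ℚ_[ℓ] (W.rationalTateModule ℓ)}
    (hb : ∀ (σ : absoluteGaloisGroup K) (i j : Fin m),
      ‖LinearMap.toMatrix b b (W.rationalGaloisRepTate ℓ σ) i j‖ ≤ 1)
    (hlow : ∀ (σ : absoluteGaloisGroup K) (i j : Fin m), j < i →
      ‖LinearMap.toMatrix b b (W.rationalGaloisRepTate ℓ σ) i j‖ < 1) :
    ∃ r₀ : absoluteGaloisGroup K →* GL (Fin m) O,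
      FramedRep.HasUpperTriangularIntegralModel
        (W.framedTateGaloisRepOfBasis ℓ (W.continuous_rationalGaloisRepTate_holds ℓ) b) r₀ :=
  exists_hasUpperTriangularIntegralModel hO _ (fun σ i j => v_entry_le_one W ℓ hb σ i j)
    fun σ i j hij => (v_entry_lt_one_iff W ℓ b σ i j).mpr (hlow σ i j hij)

end TateFrame

end Summit.Langlands.Langlands.Theorems.FiveIsogenyEllipticCurves

end
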